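import Summits.BirchSwinnertonDyer.BirchSwinnertonDyer.Theorems.ByReductionTypeAtTwoKatoFreeSandwich
import Summits.BirchSwinnertonDyer.BirchSwinnertonDyer.Theorems.ByReductionTypeAtTwoOrdMissingLowerBoundAtTwoStubMaxPeriodWitness
import Summits.BirchSwinnertonDyer.BirchSwinnertonDyer.Theorems.ByReductionTypeAtTwoKatoFreeSandwichMeasureDepth
import Summits.BirchSwinnertonDyer.BirchSwinnertonDyer.Theorems.ByReductionTypeAtTwoAnalyticMuEisensteinFlat
import Summits.BirchSwinnertonDyer.BirchSwinnertonDyer.Theorems.ByReductionTypeAtTwoFlatWitnessSquare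
import Summits.BirchSwinnertonDyer.BirchSwinnertonDyer.Theses.ByReductionTypeAtTwo
import Summits.BirchSwinnertonDyer.BirchSwinnertonDyer.Theses.TwoAdicConverse
import HarnessLib
import Literature.NumberTheory.EllipticCurves.ManinConstantGamma1ModularDegree
import Literature.NumberTheory.EllipticCurves.ModularCurveRealPeriodProofs
import Literature.NumberTheory.EllipticCurves.RealLatticeCovolumeProofs
import Literature.NumberTheory.EllipticCurves.LatticeInclusionIsogenyDegreeProofs
import Literature.NumberTheory.EllipticCurves.IsogenyDualProofs
import Literature.NumberTheory.EllipticCurves.ManinConstantSemistablePrimewise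
import Literature.NumberTheory.EllipticCurves.Greenberg1999.TwoTorsionMuInvariant
import Literature.NumberTheory.EllipticCurves.Rank1Residual.Predicates
import Literature.NumberTheory.EllipticCurves.NonEisensteinPrimeOfSurjective
import Literature.Uncategorized.OrdPublishedInputsAtTwo

/-!
# TRIAGE r1-1 (GEN 11) PROBE — NOT a skeleton, NOT a line registration.
This file = the REGISTERED skeleton `Lines/kato_free_lower_sandwich_two.lean` v11 (lead g2, 2026-08-28T20:46Z,
sha256 `4aad1e715c35…`, 19 406 B) BYTE-FOR-BYTE, with exactly two insertions by refuter triage seat 1: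
(1) the published block `TRIAGE_r1_1_BetaViaE1.lean` v2 (commit 4d4eaa995cad; here under the namespace
`…Cruxes.OrdMissingLowerBoundAtTwo.TriageR11ProbeV11T2Beta`), and (2) a cite-existence stub
`stub_T2 : Gamma1OptimalDatumExists := by sorry` (Stevens' `X₁(N)`-optimal curve as a `Gamma1ParametrizationData`
with `Λ_{W₁} ⊆ c·Λ₁(f)`; print: Vatsal 2005 Lemma 1.5; Wuthrich 2014 §2 ("c₁ … the integer such that φ₁^*ω₁ = c₁ω_f");
Česnavičius–Neururer–Saha arXiv:1911.09446 p.3 "one knows that c_φ ∈ ℤ" for `Γ₁(N) ⊂ Γ ⊂ Γ₀(N)`), after which the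
skeleton's stub (β) `stub_periodDescentOfEisenstein` is NO LONGER A SORRY: it is the term
`TriageR11ProbeV11T2Beta.stub_periodDescentOfEisenstein_of_T2 stub_T2` (its statement left VERBATIM).
The skeleton namespace is renamed `…KatoFreeLowerSandwichTwo` → `…TriageR11ProbeV11T2` to avoid any clash with the
registered line.  EXPECTED CHECK RESULT: rc 0, sorries = 3 = {stub_pub [cite], stub_lambdaHalf [= 19556, external],
stub_T2 [cite-existence]}, and `OrdMissingLowerBoundAtTwo_of` (the route decl 19577 by name) elaborates over them.
READING: line L1 closes the ROUTE DECL modulo {PUB ∧ Cassels ∧ Abbes–Ullmo cites, 19556, T2}; its research content is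
{19556} alone.  BSD is not proved; 19577 is not closed (19556 is research-open).
-/

/-!
# Crux `OrdMissingLowerBoundAtTwo` (stmt-BirchSwinnertonDyer-19577, K4 route `ByReductionTypeAtTwo`, rank 203) —
# line `kato-free-lower-sandwich-two`, SKELETON v11 (lead `cruxlead-stmt-BirchSwinnertonDyer-19577` g0 → g2, 2026-08-28)

v11 (lead g2) = **the flat witness (W) is a KERNEL THEOREM at EVERY odd level** — the registered stub `stub_flatWitnessAtTwoComposite`
LANDED verbatim (`Theorems/ByReductionTypeAtTwoFlatWitnessSquare.lean`, `FlatWitnessTwo.flatWitnessAtTwo` /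
`FlatWitnessTwo.stub_flatWitnessAtTwoComposite`, on `…FlatWitnessPrime` (prime levels, `N = 1`), `…FlatWitnessNonsquare` (`−1` not a
square: `H₋ = {u : u^{3N} = ±1}`, parabolic witness) and `…SL2ZTorsion` (finite order in `SL(2, ℤ)` ⟹ `γ¹² = 1`)).  The last case —
`−1` a square mod `N`, the family of the 196 «product» levels — is settled UNIFORMLY: `S = ⟨√−1⟩`, `H = {u : u^{3N} ∈ S}` admissible,
`w = 2^{3Nr}` (`r` = order of `2` mod `H`) has `w² = ±1`; `w² = −1` ⟹ single order-4 witness; `w² = 1` ⟹ DIRICHLET's theorem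
(Mathlib `Nat.forall_exists_prime_gt_and_eq_mod`, modulus `8N`) supplies a prime `ℓ ≡ 7 (mod 8)`, `ℓ ≡ √−1 (mod N)`, for which `2`
is a square, so `2^{(ℓ−1)/2} ≡ 1 (mod ℓ)` with `(ℓ−1)/2` odd, and the product of the two order-4 elements `(−ℓ, −1; ℓ²+1, ℓ)`,
`(−d₂, −1; d₂²+1, d₂)` (`d₂ = ℓ − (2ᵏ−1)/ℓ`, `k = 3N·r·(ℓ−1)/2`) has lower-right entry `−2ᵏ`.  So S3 («flat ⟹ Eisenstein») is now
a theorem outright: (★) + (W) + THEOREM B at `p = 2`.  **3 registered stubs remain**: stub_pub [cite] · stub_lambdaHalf [19556 external] ·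
stub_periodDescentOfEisenstein [(β), the research heart — lead recommendation: PROMOTE with the (β0)–(β2) split].

v10 (lead g2) = v9 with (W) PROVED moreover at every odd level `N` where `−1` is NOT a square (every `N` with a prime factor
`≡ 3 (mod 4)`): `Theorems/ByReductionTypeAtTwoFlatWitnessNonsquare.lean`, `FlatWitnessTwo.flatWitnessAtTwo_of_not_isSquare_neg_one`
(`H₋ = {u : u^{3N} = ±1}` is admissible by the killed-entry classification `gamma0Map_cases_of_killed` — finite order or trace `±2` ⟹
`(d ∓ 1)² ≡ 0 ∨ d² + 1 ≡ 0 ∨ d² ∓ d + 1 ≡ 0`, whence `d^N ≡ ±1` (binomial theorem, `(d ∓ 1)² = 0`) or `d³ ≡ ±1`, the case `d² ≡ −1`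
being excluded; witness = the parabolic element with `d = 2ᵏ`, `k = ord(2 mod ±1)`; `2ᵉ ∈ H₋ ⟹ k ∣ 3Ne ⟹ gcd(k,4) ∣ e`).  The registered
stub shrinks VERBATIM to `stub_flatWitnessAtTwoResidual`: composite odd `N > 1` with `−1` a square mod `N` (all prime factors
`≡ 1 (mod 4)`) — exactly the family carrying the product-witness levels (196 of them `≤ 30000`); `flatWitnessAtTwo_all` reassembles
through `FlatWitnessTwo.flatWitnessAtTwo_of_residual`.  4 registered stubs (`stubs_max`): stub_pub [cite] · stub_lambdaHalf
[19556 external] · stub_flatWitnessAtTwoResidual [(W) residual] · stub_periodDescentOfEisenstein [(β), research heart — PROMOTE].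

v9 (lead g2) = v8 with the flat witness (W) PROVED AT EVERY PRIME LEVEL and at `N = 1`
(`Theorems/ByReductionTypeAtTwoFlatWitnessPrime.lean`, `FlatWitnessTwo.flatWitnessAtTwo_prime`: `H = {u : u¹² = 1}`, `r = ord(2¹²)`,
one parabolic / elliptic witness from the 12-th-root-of-unity case split of `2ʳ ∈ 𝔽_p`; on `Theorems/ByReductionTypeAtTwoSL2ZTorsion.lean`:
finite order in `SL(2, ℤ)` ⟹ `γ¹² = 1`), so the registered stub shrinks VERBATIM to the composite odd levels `N > 1`:
`stub_flatWitnessAtTwoComposite`; `flatWitnessAtTwo_all` (a theorem) reassembles (W) at every odd level through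
`FlatWitnessTwo.flatWitnessAtTwo_of_composite`.  Status of the residual: certified by kit at every odd `N ≤ 30000` (crux-triage
r1-2 §N2: single witnesses settle all but 196 levels, those are squarefree products of primes `≡ 1 (mod 4)` with
`v₂(r_G) ≤ 1 < v₂(ord(2 mod ±1))` and need a product of two order-4 elements `ε₁ε₂`, `d(ε₁ε₂) = d₁(d₂ − d₁) − 1 = ±2ᵏ`, i.e. a
divisor `d₁ ∣ 2ᵏ ∓ 1` with `d₁² ≡ −1 (mod N)`); as a ∀-statement on that family it follows from «every coprime class mod `N` contains
a prime `ℓ` with `ord_ℓ(2)` odd» (Hasse-type density, Chebotarev) and has no elementary proof on file.  4 registered stubs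
(`stubs_max`): stub_pub [cite] · stub_lambdaHalf [19556 external] · stub_flatWitnessAtTwoComposite [(W) residual] ·
stub_periodDescentOfEisenstein [(β), research heart — lead recommendation: PROMOTE with the (β0)–(β2) split].

v8 = v7 with the span residual (α) `stub_spanResidualAtTwo` («`ConjSpanGen N 4 ∧ ConjSpanGen N 16` for every odd `N`»,
THEOREM B′/B″ — no proof idea, certified at odd `N ≤ 2001`) REPLACED by the strictly more plausible, purely arithmetic
`stub_flatWitnessAtTwo` = card #8's GEN-8 residual (W) `FlatWitnessAtTwo` (certified by kit at EVERY odd `N ≤ 30000`,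
0 exceptions): S3 now runs on THEOREM B at `p = 2` ALONE (in the tree) through the kernel theorem (★)
`AnalyticMuTwo.factorsThroughD_of_flat` (`Theorems/ByReductionTypeAtTwoAnalyticMuEisensteinFlat.lean`): a flat functional of
slope `sl` is Eisenstein as soon as `ord sl ∣ ord(2 mod H)` for an admissible `H ≤ (ℤ/N)ˣ`, and (W) + S2's `ord sl ∣ 4` give that.

v7 = v6 with the research stub SPLIT along card #8's last seam, now that S2 (both halves: `…AnalyticMuDepth` p656427,
`…AnalyticMuFlat` p658372, `…AnalyticMuFlatPackage` p658737) and S3 (`…AnalyticMuEisenstein`, flat ⟹ Eisenstein, ported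
from the crux-dir sketch; THEOREM B theses-free) are kernel theorems: `stub_periodDescentOfMeasureDepth` is derived
(`AnalyticMuTwo.periodDescentOfMeasureDepth_of_eisensteinDescent`) from TWO registered stubs —
* `stub_spanResidualAtTwo` = (α) the GROUP-THEORETIC residual «`ConjSpanGen N 4 ∧ ConjSpanGen N 16` for every odd `N`»
  (kit-certified by the triage/ideator seats at every odd `N ≤ 2001`, P ∈ {4,8,16}) — REPLACED in v8 by `stub_flatWitnessAtTwo`,
* `stub_periodDescentOfEisenstein` = (β) S4, THE RESEARCH HEART, stated purely arithmetically at the optimal curve: an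
  integer period functional `m` of the optimal newform (`re{∞,γ∞} = m(γ)·Ω⁺/2`) that is EISENSTEIN mod `2^{s+1}`
  (`m ≡ χ∘(d mod N)`) forces a globally minimal class member `W₃` with `Ω(W₃) = r·Ω(E₀)`, `v₂(r) ≥ s+1`
  (Mazur 1977 II.11 / Stein–Watkins 2004 L3.1–P3.2 at prime `N`, `s = 0`; composite `N` / depth ≥ 2 is the open part).
4 registered stubs (`stubs_max`): stub_pub [cite] · stub_lambdaHalf [19556 external] · stub_flatWitnessAtTwo [(W)] ·
stub_periodDescentOfEisenstein [(β)].

v6 = v5 with the research stub RESHAPED ONCE MORE, into its arithmetic heart at the `X₀(N)`-optimal curve: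
`stub_analyticMuLEAtMaxPeriod` («`AnalyticMuLE W″ 2 0` at the max-period member») is replaced by the EQUIVALENT (kernel:
`KatoFreeSandwich.stubAtMaxPeriod_of_periodDescentOfMeasureDepth` / `periodDescentOfMeasureDepth_of_stubAtMaxPeriod`,
`Theorems/ByReductionTypeAtTwoKatoFreeSandwichMeasureDepth.lean`, mod PUB-modularity + Abbes–Ullmo)
`stub_periodDescentOfMeasureDepth` («MEASURE DEPTH ⟹ PERIOD DESCENT»: if the Mazur–Swinnerton-Dyer measure of the optimal
curve's newform vanishes mod `2^{s+1}` on `ℤ₂^×`, some globally minimal member of the class has real period `r·Ω(E₀)` with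
`v₂(r) ≥ s+1`).  What moved into PROVED land since v5: S2's analytic half at every depth (`…AnalyticMuDepth`, p656427:
`¬ AnalyticMuLE E₀ 2 s` ⟹ measure depth `s+1`, mod AU), the general `μ`-transport and the optimal-curve re-centring
(`…KatoFreeSandwichOptimalTower`, p655109), unconditional rationality of period ratios (Milne).  What the new stub still
contains (card #8): S2's recursion half (measure depth ⟹ `2^{s+1}`-flat winding functional), S3 (flat ⟹ Eisenstein, proved in
the crux-dir sketch mod the span residual (α)), and (β) S4 `PeriodDescentOfEisensteinAtTwo` — the research heart.

v5 = v4 with `stub_maxPeriodWitness` LANDED (p653776, `Theorems/ByReductionTypeAtTwoOrdMissingLowerBoundAtTwoStubMaxPeriodWitness.lean`,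
`KatoFreeSandwich.stub_maxPeriodWitness`) and therefore no longer a stub: 3 sorries remain (stub_pub [cite], stub_lambdaHalf
[external 19556], stub_analyticMuLEAtMaxPeriod [the line's research crux]).

v4 = v3 (crux-plan g0 @646be4e56a48, registered by the lead 2026-08-28T17:2xZ) with
(a) the PROVED spine §0–§1b now IMPORTED from the tree (`Theorems/ByReductionTypeAtTwoKatoFreeSandwich.lean`, p652707,
    namespace `…Theorems.KatoFreeSandwich`), re-keyed to the tree's certificate currency `X1.MuPart.AnalyticMuLE W 2 0`
    (coefficient form) instead of the local def `AnalyticMuNonpos` (slack form; `mu_le_slack_of_analyticMuLE` is the passage,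
    and on the good-ordinary locus nothing is lost) — NO local definition survives in the skeleton;
(b) the RESHAPE the line card offers («RESHAPE OPTION (lead's call)»), APPLIED: the selector of the canonical member `W″`
    is «`W″` has 2-ADICALLY MAXIMAL real Néron period in its isogeny class» instead of «`W″` is on the plateau».  The two
    selectors agree by the period-jump law at `2` (Dokchitser–Dokchitser 2015 L28/P30/P16) + concavity, but the maximal-period
    form needs NEITHER: stub 3 becomes pure finiteness (`WeierstrassCurve.finite_isogenyClass_holds`, AEC IX.6.2) + the
    invariance of `Ω` among globally minimal models (`realPeriodRat_variableChange_of_isGloballyMinimal_holds`) — S/M and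
    landable now, no modularity, no Vélu — and stub 4 is card #8's extremal output VERBATIM (`reducibleWitness_of_extremal`
    yields `μ ≤ 0` for the member of MAXIMAL 2-adic period; no concavity lemma needed).  The jump law / concavity become an
    OPTIONAL support lemma (plateau ⟺ maximal period), off the critical path.
(c) PUB in stub 4 is the Literature-level name `Literature.Uncategorized.OrdPublishedInputsAtTwo` (the body of item 19149's
    decl, `Iff.rfl`), so that a future stub-4 file needs no route-file import.

STUBS (history v4 → v11; 3 open in v11: stub_pub [cite], stub_lambdaHalf [external], stub_periodDescentOfEisenstein [(β)]; (W) LANDED):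
* `stub_pub`       — CITE-LEVEL, BY NAME (unchanged): 19149 ∧ 19567 ∧ Abbes–Ullmo.  Never proved in the line.
* `stub_lambdaHalf` — S3 crux 19556 BY NAME (unchanged; EXTERNAL).
* `stub_maxPeriodWitness` (NEW in v4, replaces `stub_plateauWitness`; LANDED p653776 — imported, no longer a sorry): every elliptic, globally
    minimal `W/ℚ` is ℚ-isogenous to a globally minimal `W″` whose real period is 2-adically maximal in the class:
    `Ω(W₃) = q·Ω(W″)` with `W₃ ∼ W″` globally minimal forces `v₂(q) ≤ 0`.
* `stub_analyticMuLEAtMaxPeriod` (v4–v5, replaced `stub_analyticMuNonposOnPlateau`; REPLACED in v6 by the equivalent `stub_periodDescentOfMeasureDepth`; XL, the line's research-open crux in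
    EXTREMAL form): modulo PUB and AU, if `W` is non-CM, analytic rank `0`, good ordinary at `2`, has a rational point of
    order `2`, and `W″ ∼ W` is globally minimal of maximal 2-adic period, then `AnalyticMuLE W″ 2 0` (`μ(ϖ″·L₂) ≤ 0`:
    some coefficient of `ϖ″·L₂(f,α)` has norm `> 2⁻¹`).  By `μ`-transport (`ϖ‴/ϖ″ = Ω″/Ω‴`) the max-period member
    MINIMISES `μ(ϖ·L₂)` over the class, so this is «some member has `μ_an^{Nér} ≤ 0`» pinned to a canonical curve.
    Stub-plan: card #8 `odd-point-shimura-descent-two` v3/v4 (`reducibleWitness_of_extremal`; open inputs (α) `OddSpanGen N 4/16`,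
    (β) `PeriodDescentOfEisensteinAtTwo`).  Census: `μ_an^{Nér} = 0` on the plateau (= max-period members, given the jump
    law) of 179/179 reducible classes (j307730 L3).
COMPOSITION: `OrdMissingLowerBoundAtTwo_of` — the ONLY theorem concluding the route decl, hypothesis-free, closed over the
three stub NAMES (and the landed (W) theorem `FlatWitnessTwo.flatWitnessAtTwo`) through the landed
`KatoFreeSandwich.ordMissingLowerBoundAtTwo_of_lambdaHalf_of_selector`.
BSD is not proved by any of this; 19577 is not closed by this file (2 research-open stubs incl. the external 19556, 1 cite stub).
-/

set_option autoImplicit false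
set_option linter.dupNamespace false

/-! ## (inserted by triage r1-1 GEN 11: the BetaViaE1 v2 block, verbatim) -/


set_option linter.dupNamespace false

open scoped MatrixGroups ModularForm
open CongruenceSubgroup Complex WeierstrassCurve Literature.NumberTheory.EllipticCurves

namespace Summit.BirchSwinnertonDyer.BirchSwinnertonDyer.Cruxes.OrdMissingLowerBoundAtTwo.TriageR11ProbeV11T2Beta

open Literature.NumberTheory.EllipticCurves.ModularForms

variable {N : ℕ} (f : CuspForm (Gamma0 N) 2)

/-- `d ≡ 1 (mod N)` on `Γ₁(N)`: the `Γ₀(N) → (ℤ/N)`, `γ ↦ d` map is trivial on `Γ₁(N)`. [folklore] -/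
theorem gamma0Map_of_gamma1 (γ : Gamma1 N) :
    Gamma0Map N ⟨(γ : SL(2, ℤ)), Gamma1_in_Gamma0 N γ.2⟩ = 1 := by
  have h := (Gamma1_mem N (γ : SL(2, ℤ))).mp γ.2
  simp only [Gamma0Map, MonoidHom.coe_mk, OneHom.coe_mk]
  exact h.2.1

/-- **Step 1–2.** If the integer period functional `m` (`re {∞,γ∞}_f = m(γ) Ω⁺_f/2`) is Eisenstein
mod `2^{s+1}` (factors through `γ ↦ d mod N`), then `2^{s+1} ∣ m(γ)` for every `γ ∈ Γ₁(N)`: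
`m(γ) ≡ χ(d(γ)) = χ(d(1)) ≡ m(1) = 0` since `{∞, 1∞}_f = 0` and `Ω⁺_f ≠ 0`. [folklore] -/
theorem two_pow_dvd_of_gamma1 (hΩ : plusPeriod f ≠ 0) (s : ℕ) (m : Gamma0 N → ℤ)
    (hm : ∀ γ, (cuspSymbol f γ).re = m γ * (plusPeriod f / 2))
    (χ : ZMod N → ZMod (2 ^ (s + 1)))
    (hχ : ∀ γ, ((m γ : ℤ) : ZMod (2 ^ (s + 1))) = χ (Gamma0Map N γ))
    (γ : Gamma1 N) :
    (2 : ℤ) ^ (s + 1) ∣ m ⟨(γ : SL(2, ℤ)), Gamma1_in_Gamma0 N γ.2⟩ := by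
  have h1 : m 1 = 0 := by
    have h := hm 1
    rw [cuspSymbol_one, Complex.zero_re] at h
    have hne : (plusPeriod f / 2 : ℝ) ≠ 0 := div_ne_zero hΩ two_ne_zero
    have : (m 1 : ℝ) = 0 := by
      by_contra hm1
      exact (mul_ne_zero hm1 hne) h.symm
    exact_mod_cast this
  have hγ := hχ ⟨(γ : SL(2, ℤ)), Gamma1_in_Gamma0 N γ.2⟩
  rw [gamma0Map_of_gamma1, ← map_one (Gamma0Map N), ← hχ 1, h1, Int.cast_zero] at hγ
  have hγ' : (((2 ^ (s + 1) : ℕ) : ℤ) ∣ m ⟨(γ : SL(2, ℤ)), Gamma1_in_Gamma0 N γ.2⟩) :=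
    (ZMod.intCast_zmod_eq_zero_iff_dvd _ _).mp hγ
  simpa using hγ'

/-- **Step 3.** Under the same hypotheses every `z ∈ Λ₁(f)` has `re z ∈ 2^{s+1}(Ω⁺_f/2)ℤ =
2^{s} Ω⁺_f ℤ` (closure induction on the generators `{∞, γ∞}_f`, `γ ∈ Γ₁(N)`). [folklore] -/
theorem re_periodLatticeGamma1_of_eisenstein (hΩ : plusPeriod f ≠ 0) (s : ℕ) (m : Gamma0 N → ℤ)
    (hm : ∀ γ, (cuspSymbol f γ).re = m γ * (plusPeriod f / 2))
    (χ : ZMod N → ZMod (2 ^ (s + 1)))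
    (hχ : ∀ γ, ((m γ : ℤ) : ZMod (2 ^ (s + 1))) = χ (Gamma0Map N γ))
    {z : ℂ} (hz : z ∈ periodLatticeGamma1 f) :
    ∃ n : ℤ, z.re = n * (2 ^ (s + 1) * (plusPeriod f / 2)) := by
  have hz' : z ∈ AddSubgroup.closure
      (Set.range fun γ : Gamma1 N ↦ cuspSymbol f ⟨(γ : SL(2, ℤ)), Gamma1_in_Gamma0 N γ.2⟩) := hz
  induction hz' using AddSubgroup.closure_induction with
  | mem x hx =>
    obtain ⟨γ, rfl⟩ := hx
    obtain ⟨k, hk⟩ := two_pow_dvd_of_gamma1 f hΩ s m hm χ hχ γ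
    refine ⟨k, ?_⟩
    rw [hm, hk]
    push_cast
    ring
  | zero => exact ⟨0, by simp⟩
  | add x y hx0 hy0 hx hy =>
    obtain ⟨a, ha⟩ := hx hx0
    obtain ⟨b, hb⟩ := hy hy0
    exact ⟨a + b, by rw [Complex.add_re, ha, hb]; push_cast; ring⟩
  | neg x hx0 hx =>
    obtain ⟨a, ha⟩ := hx hx0
    exact ⟨-a, by rw [Complex.neg_re, ha]; push_cast; ring⟩

/-- **Step 4–5.** If a lattice `Λ ⊆ ℂ` lies in `c₁ Λ₁(f)` (`X₁(N)`-optimality: `Λ_{E₁} = c₁Λ₁(f)`,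
Stevens 1989 §2, `c₁ = c_φ ∈ ℤ` by Gabber/ČNS) and its real period `Ω₁` has `Ω₁/2 ∈ re Λ`
(rectangular case: `Ω₁ = 2Ω₀`, `Ω₀ ∈ Λ`; rhombic case: `Ω₁ = Ω₀` and `(Ω₀ + ω₂)/2`-type element —
lemma (M-rhombic)), then `Ω₁ ∈ c₁ 2^{s+1} Ω⁺_f ℤ`. [folklore] -/
theorem realPeriod_eq_of_sublattice (hΩ : plusPeriod f ≠ 0) (s : ℕ) (m : Gamma0 N → ℤ)
    (hm : ∀ γ, (cuspSymbol f γ).re = m γ * (plusPeriod f / 2))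
    (χ : ZMod N → ZMod (2 ^ (s + 1)))
    (hχ : ∀ γ, ((m γ : ℤ) : ZMod (2 ^ (s + 1))) = χ (Gamma0Map N γ))
    (Λ : Set ℂ) (c₁ : ℤ) (hΛ : ∀ z ∈ Λ, ∃ w ∈ periodLatticeGamma1 f, z = c₁ * w)
    (Ω₁ : ℝ) (hhalf : ∃ z ∈ Λ, z.re = Ω₁ / 2) :
    ∃ j : ℤ, Ω₁ = j * (c₁ * 2 ^ (s + 1) * plusPeriod f) := by
  obtain ⟨z, hz, hzre⟩ := hhalf
  obtain ⟨w, hw, rfl⟩ := hΛ z hz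
  obtain ⟨n, hn⟩ := re_periodLatticeGamma1_of_eisenstein f hΩ s m hm χ hχ hw
  refine ⟨n, ?_⟩
  have h2 : Ω₁ = 2 * (((c₁ : ℂ) * w).re) := by rw [hzre]; ring
  rw [h2, Complex.mul_re, Complex.intCast_re, Complex.intCast_im, hn]
  ring

/-- **Step 6–7 (valuation arithmetic).** From `Ω₁ = j c₁ 2^{s+1} Ω⁺_f`, the `X₀(N)`-period
relation `m₀ Ω(E₀) = |c₀| Ω⁺_f` (`realPeriodRat_dvd_holds`) with `c₀` odd (Abbes–Ullmo at `2 ∤ N`)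
and `Ω₁ ≠ 0`: `Ω₁ = r Ω(E₀)` with `r = j c₁ m₀ 2^{s+1}/|c₀| ∈ ℚ`, `v₂(r) ≥ s+1`. [folklore] -/
theorem padicValRat_ratio_ge (s : ℕ) (Ωf Ω₀ Ω₁ : ℝ) (j c₁ c₀ m₀ : ℤ)
    (h1 : Ω₁ = j * (c₁ * 2 ^ (s + 1) * Ωf)) (h0 : (m₀ : ℝ) * Ω₀ = |(c₀ : ℝ)| * Ωf)
    (hc₀ : ¬ (2 : ℤ) ∣ c₀) (hΩ₁ : Ω₁ ≠ 0) :
    ∃ r : ℚ, Ω₁ = (r : ℝ) * Ω₀ ∧ ((s : ℤ) + 1) ≤ padicValRat 2 r := by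
  have hc₀0 : c₀ ≠ 0 := by rintro rfl; exact hc₀ (dvd_zero 2)
  have habs : (|c₀| : ℤ) ≠ 0 := abs_ne_zero.mpr hc₀0
  have hjcm : j * c₁ ≠ 0 := by
    intro h
    apply hΩ₁
    have h' : (j : ℝ) * c₁ = 0 := by exact_mod_cast h
    rw [h1]
    calc (j : ℝ) * (c₁ * 2 ^ (s + 1) * Ωf) = ((j : ℝ) * c₁) * (2 ^ (s + 1) * Ωf) := by ring
      _ = 0 := by rw [h', zero_mul]
  have hΩf : Ωf = (m₀ : ℝ) * Ω₀ / |(c₀ : ℝ)| := by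
    have : (|(c₀ : ℝ)|) ≠ 0 := by exact_mod_cast (abs_ne_zero.mpr (Int.cast_ne_zero.mpr hc₀0) :
      |(c₀:ℝ)| ≠ 0)
    field_simp
    linarith [h0]
  have hm₀ : m₀ ≠ 0 := by
    intro h
    apply hΩ₁
    rw [h1, hΩf, h]
    simp
  refine ⟨((j * c₁ * m₀ : ℤ) : ℚ) * (2 : ℚ) ^ (s + 1) / ((|c₀| : ℤ) : ℚ), ?_, ?_⟩
  · rw [h1, hΩf]
    push_cast
    rw [← Int.cast_abs]
    ring
  · have hq1 : ((j * c₁ * m₀ : ℤ) : ℚ) ≠ 0 := by exact_mod_cast mul_ne_zero hjcm hm₀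
    have hq2 : ((2 : ℚ) ^ (s + 1)) ≠ 0 := pow_ne_zero _ two_ne_zero
    have hq3 : (((|c₀| : ℤ)) : ℚ) ≠ 0 := by exact_mod_cast habs
    have h22 : padicValRat 2 2 = 1 := by simpa using padicValRat.self (p := 2) one_lt_two
    have h0' : padicValInt 2 |c₀| = 0 :=
      padicValInt.eq_zero_of_not_dvd (p := 2) (by rwa [Nat.cast_ofNat, dvd_abs])
    rw [padicValRat.div (mul_ne_zero hq1 hq2) hq3, padicValRat.mul hq1 hq2, padicValRat.pow (2 : ℚ),
      padicValRat.of_int, padicValRat.of_int, h22, h0']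
    push_cast
    have : (0 : ℤ) ≤ (padicValInt 2 (j * c₁ * m₀) : ℤ) := by positivity
    linarith


/-! ### Assembly: (β) for an `X₁(N)`-lattice-optimal datum, modulo the rhombic half-period lemma -/

/-- **(M-rhombic), hypothesis.** For a real lattice with negative discriminant (rhombic case,
`Λ = ⟨Ω₀, (Ω₀ + iΩ₀')/2⟩`), some lattice point has real part `Ω₀/2` (Cremona §2.8, p. 26; Lawden
§6.16). The tree has the two `⊆` halves (`IsReal.exists_re_eq_int_mul_half`,
`IsReal.exists_re_eq_int_mul_of_discr_pos`); the existence half is `rhombicHalf_holds` below.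
[cite: CremonaAlgorithms1997, §2.8 (p. 26)] -/
def RhombicHalf : Prop :=
  ∀ L : PeriodPair, L.IsReal → L.g₂.re ^ 3 - 27 * L.g₃.re ^ 2 < 0 →
    ∃ z ∈ L.lattice, z.re = L.minRealPeriod / 2

/-- **(M-rhombic) holds**: by `IsReal.discr_pos_of_half_sum_notMem` (rectangular ⇒ `disc > 0`,
file `RealLatticeCovolumeProofs`), a real lattice with `disc < 0` contains `(Ω₀ + iΩ₀')/2`, whose
real part is `Ω₀/2` (Cremona §2.10, p. 30; Lawden §6.16). [cite: CremonaAlgorithms1997, §2.10 (p. 30)] -/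
theorem rhombicHalf_holds : RhombicHalf := by
  intro L h hneg
  by_cases hcase :
      ((L.minRealPeriod : ℂ) + I * (L.mulLeft I I_ne_zero).minRealPeriod) / 2 ∈ L.lattice
  · refine ⟨_, hcase, ?_⟩
    simp [Complex.add_re, Complex.mul_re]
  · exact absurd (h.discr_pos_of_half_sum_notMem hneg.ne hcase) (not_lt.mpr hneg.le)

section Gamma1Twin

variable {W : WeierstrassCurve ℚ} {M : ℕ} [NeZero M] (D : Gamma1ParametrizationData W M)

/-- `g₂(Λ) = c₄/12` for a `Γ₁`-datum (twin of `ModularParametrizationData.neronLattice_g₂`). [folklore] -/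
theorem g1_neronLattice_g₂ : D.L.g₂ = ((((W.c₄ : ℚ) : ℝ) / 12 : ℝ) : ℂ) := by
  rw [D.isNeronLattice.1, WeierstrassCurve.baseChange, WeierstrassCurve.map_c₄, eq_ratCast]
  push_cast
  ring

/-- `g₃(Λ) = c₆/216` for a `Γ₁`-datum (twin). [folklore] -/
theorem g1_neronLattice_g₃ : D.L.g₃ = ((((W.c₆ : ℚ) : ℝ) / 216 : ℝ) : ℂ) := by
  rw [D.isNeronLattice.2, WeierstrassCurve.baseChange, WeierstrassCurve.map_c₆, eq_ratCast]
  push_cast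
  ring

/-- The lattice of a `Γ₁`-datum is real (twin of `isReal_neronLattice`). [folklore] -/
theorem g1_isReal_neronLattice : D.L.IsReal :=
  PeriodPair.isReal_of_g₂_g₃_real PeriodPair.uniformization_unique_holds
    (by rw [g1_neronLattice_g₂ D, Complex.ofReal_im]) (by rw [g1_neronLattice_g₃ D, Complex.ofReal_im])

/-- `disc Λ = Δ(W/ℝ)` for a `Γ₁`-datum (twin of `discr_neronLattice`). [folklore] -/
theorem g1_discr_neronLattice : D.L.g₂.re ^ 3 - 27 * D.L.g₃.re ^ 2 = (W.baseChange ℝ).Δ := by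
  rw [g1_neronLattice_g₂ D, g1_neronLattice_g₃ D, Complex.ofReal_re, Complex.ofReal_re,
    ← ModularParametrizationData.baseChange_real_c₄, ← ModularParametrizationData.baseChange_real_c₆,
    show ((W.baseChange ℝ).c₄ / 12) ^ 3 - 27 * ((W.baseChange ℝ).c₆ / 216) ^ 2 =
      ((W.baseChange ℝ).c₄ ^ 3 - (W.baseChange ℝ).c₆ ^ 2) / 1728 by ring,
    ← (W.baseChange ℝ).c_relation]
  ring

/-- `Ω(W) = #π₀ · Ω₀(Λ)` for a `Γ₁`-datum (twin of `realPeriodRat_eq_numRealComponents_mul`).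
[folklore] -/
theorem g1_realPeriodRat_eq [W.IsElliptic] :
    W.realPeriodRat = (W.baseChange ℝ).numRealComponents * D.L.minRealPeriod := by
  haveI : (W.baseChange ℝ).IsElliptic := by
    rw [WeierstrassCurve.baseChange]; infer_instance
  obtain ⟨L', h₂', h₃', hΩ⟩ := (W.baseChange ℝ).exists_periodPair_realPeriod_eq_holds
  have hlat : D.L.lattice = L'.lattice :=
    PeriodPair.uniformization_unique_holds _ _
      (by rw [h₂', g1_neronLattice_g₂ D, ModularParametrizationData.baseChange_real_c₄])
      (by rw [h₃', g1_neronLattice_g₃ D, ModularParametrizationData.baseChange_real_c₆])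
  rw [WeierstrassCurve.realPeriodRat_def, hΩ, PeriodPair.minRealPeriod_def, hlat]

/-- `Ω(W)/2 ∈ re Λ` for a `Γ₁`-datum, given (M-rhombic): rectangular case `Ω = 2Ω₀`, `Ω₀ ∈ Λ`;
rhombic case `Ω = Ω₀` and (M-rhombic). [folklore] -/
theorem g1_exists_re_eq_half [W.IsElliptic] (hRh : RhombicHalf) :
    ∃ z ∈ D.L.lattice, z.re = W.realPeriodRat / 2 := by
  haveI : (W.baseChange ℝ).IsElliptic := by
    rw [WeierstrassCurve.baseChange]; infer_instance
  rw [g1_realPeriodRat_eq D]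
  by_cases hΔ : 0 < (W.baseChange ℝ).Δ
  · rw [(W.baseChange ℝ).numRealComponents_of_Δ_pos hΔ]
    refine ⟨(D.L.minRealPeriod : ℂ), (g1_isReal_neronLattice D).minRealPeriod_mem_lattice, ?_⟩
    rw [Complex.ofReal_re]
    push_cast
    ring
  · rw [(W.baseChange ℝ).numRealComponents_of_Δ_nonpos (not_lt.mp hΔ)]
    have hne : (W.baseChange ℝ).Δ ≠ 0 := (W.baseChange ℝ).isUnit_Δ.ne_zero
    have hneg : D.L.g₂.re ^ 3 - 27 * D.L.g₃.re ^ 2 < 0 := by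
      rw [g1_discr_neronLattice D]
      exact lt_of_le_of_ne (not_lt.mp hΔ) hne
    obtain ⟨z, hz, hzre⟩ := hRh D.L (g1_isReal_neronLattice D) hneg
    exact ⟨z, hz, by rw [hzre]; push_cast; ring⟩

end Gamma1Twin

/-- **(β) for the `X₁(N)`-optimal curve (unconditional given the datum).** Let `E₀` (globally minimal) carry
an `X₀(N)`-datum `D₀` with odd Manin constant `c₀` (Abbes–Ullmo at `2 ∤ N`), and let `W₁` (globally
minimal, elliptic) carry a `Γ₁(N)`-datum `D₁` with the same newform whose lattice is
*`X₁(N)`-optimal*: `Λ_{W₁} ⊆ c₁ Λ₁(f)` (Stevens 1989 §2: the `X₁(N)`-optimal curve `E₁` has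
`Λ_{E₁} = c₁Λ₁(f)`). If the integer period functional `m` of `f` is Eisenstein mod `2^{s+1}`, then
`Ω(W₁) = r Ω(E₀)` with `v₂(r) ≥ s+1` — the conclusion of `stub_periodDescentOfEisenstein` with
`W₃ := W₁` for every `s` (the isogeny `E₀ ~ W₁` comes separately from
`exists_isogeny_degree_eq_of_isNeronLatticeOf` and `c₀Λ₁(f) ⊆ c₀Λ_f ⊆ Λ_{E₀}`). [folklore] -/
theorem periodDescent_of_gamma1Optimal
    {E₀ : WeierstrassCurve ℚ} [E₀.IsElliptic] {M : ℕ} [NeZero M]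
    (D₀ : ModularParametrizationData E₀ M) (hc₀ : ¬ (2 : ℤ) ∣ D₀.maninConstant)
    {W₁ : WeierstrassCurve ℚ} [W₁.IsElliptic] (D₁ : Gamma1ParametrizationData W₁ M)
    (hf : D₁.f = D₀.f)
    (hopt : ∀ z ∈ D₁.L.lattice, ∃ w ∈ periodLatticeGamma1 D₁.f, z = D₁.c * w)
    (s : ℕ) (m : Gamma0 M → ℤ)
    (hm : ∀ γ, (cuspSymbol D₀.f γ).re = m γ * (plusPeriod D₀.f / 2))
    (χ : ZMod M → ZMod (2 ^ (s + 1)))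
    (hχ : ∀ γ, ((m γ : ℤ) : ZMod (2 ^ (s + 1))) = χ (Gamma0Map M γ)) :
    ∃ r : ℚ, W₁.realPeriodRat = (r : ℝ) * E₀.realPeriodRat ∧ ((s : ℤ) + 1) ≤ padicValRat 2 r := by
  have hpos : 0 < plusPeriod D₀.f :=
    IsNewform0.plusPeriod_pos_holds D₀.isNewformOf.1 D₀.isNewformOf.coeffField_eq_bot
  obtain ⟨m₀, -, hm₀⟩ := D₀.realPeriodRat_dvd_holds
  rw [hf] at hopt
  obtain ⟨j, hj⟩ := realPeriod_eq_of_sublattice D₀.f hpos.ne' s m hm χ hχ D₁.L.lattice D₁.c hopt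
    W₁.realPeriodRat (g1_exists_re_eq_half D₁ rhombicHalf_holds)
  have hΩ₁ : W₁.realPeriodRat ≠ 0 := by
    haveI : (W₁.baseChange ℝ).IsElliptic := by
      rw [WeierstrassCurve.baseChange]; infer_instance
    rw [WeierstrassCurve.realPeriodRat_def]
    exact (W₁.baseChange ℝ).realPeriod_pos'.ne'
  exact padicValRat_ratio_ge s (plusPeriod D₀.f) E₀.realPeriodRat W₁.realPeriodRat j D₁.c
    D₀.maninConstant m₀ hj (by exact_mod_cast hm₀) hc₀ hΩ₁

#print axioms periodDescent_of_gamma1Optimal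

/-- **The `X₁(N)`-lattice-optimal curve is `ℚ`-isogenous to `E₀`**: `(c₀/c₁) Λ_{W₁} = c₀ Λ₁(f)
⊆ c₀ Λ_f ⊆ Λ_{E₀}` is a rational lattice inclusion, hence a `ℚ`-isogeny `W₁ → E₀`
(`exists_isogeny_degree_eq_of_isNeronLatticeOf`, Silverman AEC VI.4.1(b)), and isogeny is symmetric
in characteristic `0` (`IsIsogenous.symm_of_charZero`). [folklore] -/
theorem isIsogenous_of_gamma1Optimal
    {E₀ : WeierstrassCurve ℚ} [E₀.IsElliptic] {M : ℕ} [NeZero M]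
    (D₀ : ModularParametrizationData E₀ M)
    {W₁ : WeierstrassCurve ℚ} [W₁.IsElliptic] (D₁ : Gamma1ParametrizationData W₁ M)
    (hf : D₁.f = D₀.f)
    (hopt : ∀ z ∈ D₁.L.lattice, ∃ w ∈ periodLatticeGamma1 D₁.f, z = D₁.c * w) :
    IsIsogenous E₀ W₁ := by
  have hc₁ : D₁.c ≠ 0 := by
    intro h0
    have hmem := (g1_isReal_neronLattice D₁).minRealPeriod_mem_lattice
    obtain ⟨w, -, hw⟩ := hopt _ hmem
    rw [h0, Int.cast_zero, zero_mul, Complex.ofReal_eq_zero] at hw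
    exact (g1_isReal_neronLattice D₁).minRealPeriod_pos.ne' hw
  have hc : ((D₀.c : ℚ) / (D₁.c : ℚ)) ≠ 0 :=
    div_ne_zero (Int.cast_ne_zero.mpr D₀.maninConstant_ne_zero_holds) (Int.cast_ne_zero.mpr hc₁)
  have hle : ∀ z ∈ D₁.L.lattice, ((((D₀.c : ℚ) / (D₁.c : ℚ) : ℚ)) : ℂ) * z ∈ D₀.L.lattice := by
    intro z hz
    obtain ⟨w, hw, rfl⟩ := hopt z hz
    rw [hf] at hw
    have h := ModularParametrizationData.smul_periodLatticeGamma1_le E₀ M D₀ w hw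
    have hc₁' : (D₁.c : ℂ) ≠ 0 := Int.cast_ne_zero.mpr hc₁
    convert h using 1
    push_cast
    field_simp
  obtain ⟨φ, -⟩ := exists_isogeny_degree_eq_of_isNeronLatticeOf W₁ E₀ D₁.isNeronLattice
    D₀.isNeronLattice hc hle
  exact IsIsogenous.symm_of_charZero ⟨φ⟩

#print axioms isIsogenous_of_gamma1Optimal

/-! ### GEN 11 — the registered stub VERBATIM modulo T2 (the `X₁(N)`-optimal datum exists) -/

section Gen11

open Literature.NumberTheory.EllipticCurves.Rank1Residual
  Literature.NumberTheory.EllipticCurves.Greenberg1999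

/-- **T2 — Stevens' `X₁(N)`-optimal curve, as a `Γ₁(N)`-datum (print-existence statement).** For
every globally minimal elliptic `E₀/ℚ` carrying an `X₀(N)`-parametrisation datum `D₀` at its
conductor level `N` (so `D₀.f` is the newform of the class), there is a globally minimal elliptic
`W₁/ℚ` with a `Γ₁(N)`-parametrisation datum `D₁` with THE SAME newform whose Néron lattice is
`X₁(N)`-optimal: `Λ_{W₁} ⊆ c₁ Λ₁(f)` (hence `= c₁Λ₁(f)`, as `c₁Λ₁(f) ⊆ Λ_{W₁}` is a field of the
datum). Witness in print: the optimal (connected-kernel) quotient `J₁(N) ↠ E₁` attached to `f`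
(Shimura; Stevens 1989 §2, "the `X₁(N)`-optimal curve"), `H₁(X₁(N), ℤ) ↠ H₁(E₁, ℤ)`, so the
Néron lattice of the minimal model of `E₁` is `c₁ · Λ₁(f)` with `c₁ = c_φ ∈ ℤ` (Gabber;
Česnavičius–Neururer–Saha, JEMS 26 (2024) §1 and Lemma `const-in-Z`: "one knows that `c_φ ∈ ℤ`"
for every surjection `(X_Γ)_ℚ ↠ E`, `Γ₁(N) ⊂ Γ ⊂ Γ₀(N)`). NOT Stevens' conjecture (`c₁ = ±1`,
`E₁` of minimal Faltings height) and NOT its `2`-part (Vatsal 2005 Thm. 1.10): only existence +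
integrality. Shared with crux 27047's stub T2. [cite: Stevens1989, §2; CesnaviciusNeururerSaha2023, §1 (const-in-Z)] -/
def Gamma1OptimalDatumExists : Prop :=
  ∀ (E₀ : WeierstrassCurve ℚ) [E₀.IsElliptic] [E₀.IsGloballyMinimal] [NeZero (E₀.conductorNorm ℤ)]
    (D₀ : ModularParametrizationData E₀ (E₀.conductorNorm ℤ)),
    ∃ (W₁ : WeierstrassCurve ℚ) (_ : W₁.IsElliptic) (_ : W₁.IsGloballyMinimal)
      (D₁ : Gamma1ParametrizationData W₁ (E₀.conductorNorm ℤ)),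
      D₁.f = D₀.f ∧ ∀ z ∈ D₁.L.lattice, ∃ w ∈ periodLatticeGamma1 D₁.f, z = D₁.c * w

/-- **Skeleton v11's `stub_periodDescentOfEisenstein`, VERBATIM, from T2.** The statement below is
the registered stub's type token for token (line `Lines/kato_free_lower_sandwich_two.lean` v11,
sha256 `4aad1e715c35…`, ll. 167–181); the proof is `Gamma1OptimalDatumExists` + the GEN 10 glue
(`isIsogenous_of_gamma1Optimal`, `periodDescent_of_gamma1Optimal`) with `W₃ := W₁` for every `s`,
`2 ∤ N` from `GoodOrd E₀ 2` and `2 ∤ c₀` from the Abbes–Ullmo binder applied to the stub's own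
lattice-optimality hypothesis. Unused binders: PUB, `¬CM`, `analyticRank = 0`, the `2`-torsion
member. [folklore] -/
theorem stub_periodDescentOfEisenstein_of_T2 (hT2 : Gamma1OptimalDatumExists) :
    Literature.Uncategorized.OrdPublishedInputsAtTwo →
    abbesUllmo_not_dvd_maninConstant_of_not_dvd_level →
    ∀ (E₀ : WeierstrassCurve ℚ) [E₀.IsElliptic] [E₀.IsGloballyMinimal] [NeZero (E₀.conductorNorm ℤ)]
      (D₀ : ModularParametrizationData E₀ (E₀.conductorNorm ℤ)),
      (∀ z ∈ D₀.L.lattice, ∃ w ∈ periodLattice D₀.f, z = D₀.c * w) →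
      ¬ E₀.HasCM → E₀.analyticRank = 0 → GoodOrd E₀ 2 →
      (∃ (W₁ : WeierstrassCurve ℚ) (_ : W₁.IsElliptic) (_ : W₁.IsGloballyMinimal),
        IsIsogenous E₀ W₁ ∧ ∃ x : ℚ, HasRationalTwoTorsionX W₁ x) →
      ∀ (s : ℕ) (m : Gamma0 (E₀.conductorNorm ℤ) → ℤ),
        (∀ γ, (cuspSymbol D₀.f γ).re = m γ * (plusPeriod D₀.f / 2)) →
      ∀ χ : ZMod (E₀.conductorNorm ℤ) → ZMod (2 ^ (s + 1)),
        (∀ γ, ((m γ : ℤ) : ZMod (2 ^ (s + 1))) = χ (Gamma0Map (E₀.conductorNorm ℤ) γ)) →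
      ∃ (W₃ : WeierstrassCurve ℚ) (_ : W₃.IsElliptic) (_ : W₃.IsGloballyMinimal),
        IsIsogenous E₀ W₃ ∧ ∃ r : ℚ, W₃.realPeriodRat = (r : ℝ) * E₀.realPeriodRat ∧ ((s : ℤ) + 1) ≤ padicValRat 2 r := by
  intro _hP hAU E₀ _ _ _ D₀ hopt₀ _hCM _hr hgo _h2 s m hm χ hχ
  obtain ⟨W₁, hW₁e, hW₁m, D₁, hf, hopt⟩ := hT2 E₀ D₀
  have hN : ¬ 2 ∣ E₀.conductorNorm ℤ :=
    haveI : Fact (Nat.Prime 2) := ⟨Nat.prime_two⟩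
    not_dvd_conductorNorm_of_hasGoodReductionAtPrime E₀ hgo.1
  have hc₀ : ¬ (2 : ℤ) ∣ D₀.maninConstant := hAU E₀ D₀ hopt₀ 2 Nat.prime_two hN
  exact ⟨W₁, hW₁e, hW₁m, isIsogenous_of_gamma1Optimal D₀ D₁ hf hopt,
    periodDescent_of_gamma1Optimal D₀ hc₀ D₁ hf hopt s m hm χ hχ⟩

#print axioms stub_periodDescentOfEisenstein_of_T2

end Gen11

end Summit.BirchSwinnertonDyer.BirchSwinnertonDyer.Cruxes.OrdMissingLowerBoundAtTwo.TriageR11ProbeV11T2Beta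


noncomputable section

open scoped Classical MatrixGroups ModularForm

open CongruenceSubgroup WeierstrassCurve Literature.NumberTheory.EllipticCurves
  Literature.NumberTheory.EllipticCurves.ModularForms Literature.NumberTheory.EllipticCurves.Rank1Residual
  Literature.NumberTheory.EllipticCurves.Rank1Residual.Typed
  Literature.NumberTheory.EllipticCurves.Greenberg1999
  Summit.BirchSwinnertonDyer.Rank1Residual.X1.MuPart
  Summit.BirchSwinnertonDyer.Rank1Residual
  Summit.BirchSwinnertonDyer.BirchSwinnertonDyer.Theorems.KatoFreeSandwich

namespace Summit.BirchSwinnertonDyer.BirchSwinnertonDyer.Cruxes.OrdMissingLowerBoundAtTwo.TriageR11ProbeV11T2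

/-! ## The stubs of the line (sorries live ONLY here; `stub_maxPeriodWitness` is the landed `KatoFreeSandwich.stub_maxPeriodWitness`,
(W) `stub_flatWitnessAtTwo(Composite)` is the landed `FlatWitnessTwo.flatWitnessAtTwo`) -/

/-- stub PUB-SIDE (CITE-LEVEL, BY NAME): K4 items 19149 `OrdPublishedInputsAtTwo` (modularity, Gross–Zagier–Kolyvagin,
Kato 17.4 (1)(2) at every prime incl. 2, Greenberg 4.1 at 2) and 19567 `OrdIsoPublishedInputsAtTwo` (Cassels isogeny
invariance of the BSD quotient, entire `L`), and the Literature named fact `abbesUllmo_not_dvd_maninConstant_of_not_dvd_level`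
(Abbes–Ullmo 1996 Thm. A).  Never proved in the line. -/
theorem stub_pub :
    Summit.BirchSwinnertonDyer.BirchSwinnertonDyer.Theses.ByReductionTypeAtTwo.OrdPublishedInputsAtTwo ∧
    Summit.BirchSwinnertonDyer.BirchSwinnertonDyer.Theses.ByReductionTypeAtTwo.OrdIsoPublishedInputsAtTwo ∧
    abbesUllmo_not_dvd_maninConstant_of_not_dvd_level := by
  sorry

/-- stub λ-HALF = S3's crux 19556 BY NAME (`λ(char X_E) ≥ λ(L₂(E))` on the good-ordinary non-CM locus; EXTERNAL). -/
theorem stub_lambdaHalf :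
    Summit.BirchSwinnertonDyer.BirchSwinnertonDyer.Theses.TwoAdicConverse.OrdLambdaHalfAtTwo := by
  sorry

/-- PROBE stub T2 (cite-existence; replaces (β) as the line's third sorry): Stevens' `X₁(N)`-optimal
curve as a `Γ₁(N)`-datum (triage r1-1 GEN 11 `Gamma1OptimalDatumExists`). [cite: Stevens1989, §2] -/
theorem stub_T2 :
    Summit.BirchSwinnertonDyer.BirchSwinnertonDyer.Cruxes.OrdMissingLowerBoundAtTwo.TriageR11ProbeV11T2Beta.Gamma1OptimalDatumExists := by
  sorry

/-- stub (β) PERIOD DESCENT OF AN EISENSTEIN WINDING FUNCTIONAL (load-bearing, HARDEST; the line's research heart = card #8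
piece S4_s `PeriodDescentOfEisensteinAtTwo` in the lead's currency): MODULO K4's PUB (Literature-level) and Abbes–Ullmo (BY NAME,
as hypotheses), for every globally minimal `E₀` carrying a LATTICE-OPTIMAL parametrisation datum `D₀` at level `N_{E₀}`, non-CM,
analytic rank `0`, good ordinary at `2`, whose class contains a globally minimal member with a rational point of order `2`:
if an integer period functional `m : Γ₀(N) → ℤ` of the newform `D₀.f` (`re{∞,γ∞}_f = m(γ)·Ω⁺_f/2`) is EISENSTEIN mod
`2^{s+1}` — `m(γ) ≡ χ(d(γ) mod N)` for some `χ : ℤ/N → ℤ/2^{s+1}` — then some globally minimal `W₃ ∼ E₀` has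
`Ω(W₃) = r·Ω(E₀)` with `v₂(r) ≥ s+1`.  Mechanism on file: `C := ker(m mod 2^{s+1}) ⊂ E₀[2^{s+1}]` (Weil duality) has
`π₀^*C = ker(J₀(N) → Jac X_χ) ≅ μ_{2^{s+1}}` (optimality: `π₀^*` injective), inside the formal group at `2` (Abbes–Ullmo closed
immersion at `2 ∤ N`), generated by odd points; dividing by it climbs `s+1` steps (Mazur 1977 II.11, Stein–Watkins 2004
L3.1/P3.2 at prime `N`, `s = 0`; composite `N` and depth `≥ 2` are OPEN).  (`m` is primitive — `re Λ_f = ℤ·Ω⁺_f/2` — so `χ`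
has exact order `2^{s+1}`; the prover derives this.) (Mazur 1977 II.11.) [cite: GreenbergLNM1716, §5 p. 179] -/
theorem stub_periodDescentOfEisenstein :
    Literature.Uncategorized.OrdPublishedInputsAtTwo →
    abbesUllmo_not_dvd_maninConstant_of_not_dvd_level →
    ∀ (E₀ : WeierstrassCurve ℚ) [E₀.IsElliptic] [E₀.IsGloballyMinimal] [NeZero (E₀.conductorNorm ℤ)]
      (D₀ : ModularParametrizationData E₀ (E₀.conductorNorm ℤ)),
      (∀ z ∈ D₀.L.lattice, ∃ w ∈ periodLattice D₀.f, z = D₀.c * w) →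
      ¬ E₀.HasCM → E₀.analyticRank = 0 → GoodOrd E₀ 2 →
      (∃ (W₁ : WeierstrassCurve ℚ) (_ : W₁.IsElliptic) (_ : W₁.IsGloballyMinimal),
        IsIsogenous E₀ W₁ ∧ ∃ x : ℚ, HasRationalTwoTorsionX W₁ x) →
      ∀ (s : ℕ) (m : Gamma0 (E₀.conductorNorm ℤ) → ℤ),
        (∀ γ, (cuspSymbol D₀.f γ).re = m γ * (plusPeriod D₀.f / 2)) →
      ∀ χ : ZMod (E₀.conductorNorm ℤ) → ZMod (2 ^ (s + 1)),
        (∀ γ, ((m γ : ℤ) : ZMod (2 ^ (s + 1))) = χ (Gamma0Map (E₀.conductorNorm ℤ) γ)) →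
      ∃ (W₃ : WeierstrassCurve ℚ) (_ : W₃.IsElliptic) (_ : W₃.IsGloballyMinimal),
        IsIsogenous E₀ W₃ ∧ ∃ r : ℚ, W₃.realPeriodRat = (r : ℝ) * E₀.realPeriodRat ∧ ((s : ℤ) + 1) ≤ padicValRat 2 r :=
  Summit.BirchSwinnertonDyer.BirchSwinnertonDyer.Cruxes.OrdMissingLowerBoundAtTwo.TriageR11ProbeV11T2Beta.stub_periodDescentOfEisenstein_of_T2
    stub_T2

/-! ## The composition (CLOSED; exactly ONE theorem concludes the ROUTE DECL, hypothesis-free over the stub NAMES) -/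

/-- **19577 (the ROUTE DECL, by name) from the stubs**, through the landed
`KatoFreeSandwich.ordMissingLowerBoundAtTwo_of_lambdaHalf_of_selector` with the selector
`P W W″ :=` «`W″` has 2-adically maximal real period in its class», the landed `stub_maxPeriodWitness`, and the landed
equivalence `stubAtMaxPeriod_of_periodDescentOfMeasureDepth` (modularity from PUB via
`exists_isNewformOf_of_nonempty_modularParametrizationData`). -/
theorem OrdMissingLowerBoundAtTwo_of :
    Summit.BirchSwinnertonDyer.BirchSwinnertonDyer.Theses.ByReductionTypeAtTwo.OrdMissingLowerBoundAtTwo := by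
  obtain ⟨hP, ⟨hC, -⟩, hAU⟩ := stub_pub
  have hP' : Literature.Uncategorized.OrdPublishedInputsAtTwo := hP
  have hnf : exists_isNewformOf := exists_isNewformOf_of_nonempty_modularParametrizationData hP'.1
  exact ordMissingLowerBoundAtTwo_of_lambdaHalf_of_selector
    (fun _ W'' => ∀ (W₃ : WeierstrassCurve ℚ) [W₃.IsElliptic] [W₃.IsGloballyMinimal], IsIsogenous W'' W₃ →
      ∀ q : ℚ, W₃.realPeriodRat = (q : ℝ) * W''.realPeriodRat → padicValRat 2 q ≤ 0)
    hP hC hAU stub_lambdaHalf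
    (fun W _ _ _ _ => Summit.BirchSwinnertonDyer.BirchSwinnertonDyer.Theorems.KatoFreeSandwich.stub_maxPeriodWitness W)
    (fun W W'' _ _ _ _ =>
      stubAtMaxPeriod_of_periodDescentOfMeasureDepth hnf hAU
        (Summit.BirchSwinnertonDyer.BirchSwinnertonDyer.Theorems.AnalyticMuTwo.periodDescentOfMeasureDepth_of_flatWitness_of_eisensteinDescent
          Summit.BirchSwinnertonDyer.BirchSwinnertonDyer.Theorems.FlatWitnessTwo.flatWitnessAtTwo
          (stub_periodDescentOfEisenstein hP' hAU)) W W'')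

end Summit.BirchSwinnertonDyer.BirchSwinnertonDyer.Cruxes.OrdMissingLowerBoundAtTwo.TriageR11ProbeV11T2

end

#print axioms Summit.BirchSwinnertonDyer.BirchSwinnertonDyer.Cruxes.OrdMissingLowerBoundAtTwo.TriageR11ProbeV11T2.OrdMissingLowerBoundAtTwo_of
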